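import Literature.NumberTheory.GelbartRogawski1991.LocalUnitarySplittingDatum
import Literature.NumberTheory.Weil1964.DoublingDiagonalPolarisation
import HarnessLib

-- buildfix G11b-3 recipe (LEDGER B13-1/B13-3): elaborate sequentially so the trailing `attribute [implicit_reducible]`
-- block (reducibilityCoreExt is keyed to the async environment branch) is in force at `.olean` export.
set_option Elab.async false

/-!
# The doubled quasi-split unitary datum `U(𝕍 ⊕ −𝕍)` at a finite place: Gram matrix `T₀ ⊕ (−T₀)`, the
# Lagrangian `Res Δ` of the diagonal, the Siegel parabolic `P_Δ` and `det_Δ` ([Kudla1994, §3];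
# [HarrisKudlaSweet1996, §1 (1.9)–(1.11)])

Topic `NumberTheory/GelbartRogawski1991`; namespace
`Literature.NumberTheory.GelbartRogawski1991.UnitaryDualPair.LocalSplitting` (sequel of
`LocalUnitarySplittingDatum`).  KERNEL only: definitions with bodies and proved lemmas; no named fact, no `sorry`.

The DOUBLING of [Kudla1994, §3] ∕ [HarrisKudlaSweet1996, §1 (1.9)–(1.11)]: for a hermitian space `𝕍` with
`F`-rational symmetric Gram matrix `T₀ ∈ GL_n(F)`, the space `𝔻 = 𝕍 ⊕ (−𝕍)` (Gram matrix `T^𝔻 = T₀ ⊕ (−T₀)`,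
re-enumerated by `e₂ : Fin n ⊕ Fin n ≃ Fin (n + n)` so that the `Fin N`-indexed unitary-group files apply) is SPLIT:
the diagonal `Δ = {(u, u)}` ("`Y` = graph of the identity", (1.11)) is a maximal isotropic subspace, its
restriction of scalars `ℓ_Δ = Res_{E_v/F_v} Δ` is a LAGRANGIAN of the doubled local symplectic space
`𝕎^𝔻_v = F_v^{n+n} × F_v^{n+n}` (`deltaLagrangian_orthogonal`), and its stabiliser in `H = U(𝔻)` is the Siegel
parabolic `P_Δ`.  Contents:

* §1 `gramD n T₀ = reindex e₂ e₂ (fromBlocks T₀ 0 0 (−T₀))`, symmetric with unit determinant (`gramD_isSymm`,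
  `isUnit_det_gramD`), `hermD = gramD ⊗ 1`; the local pairing of the doubled datum splits as
  `β_{T^𝔻_v}(x, y) = ⟨x_L, T₀ y_L⟩ − ⟨x_R, T₀ y_R⟩` (`localPairing_gramD`);
* §2 the Lagrangian `deltaLagrangian` (pairs whose two halves agree, in both `X` and `Y` coordinates) and
  `deltaLagrangian_orthogonal : ℓ_Δ^⊥ = ℓ_Δ`;
* §3 `iotaD` (the interface's `iota` at the doubled datum), the Siegel condition `IsSiegelDelta h :⇔ ι(h) ℓ_Δ = ℓ_Δ`,
  the `Δ`-block `deltaBlock` = `h₁₁ + h₁₂` at a place `w ∣ v`, `detDelta` (Kudla's `x(p)` on `P_Δ`), and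
  `chiDet χv h = ∏_{w ∣ v} χ_w(det_Δ h_w)` for a family of local characters `χ_w : E_wˣ →* ℂˣ`.

Written for the kernel construction of [GelbartRogawski1991, Prop. 3.1.1] behind the cited input `hGRU` of the
Hodge-CM period-theorem package (stage-1 cell `pub-hodgecm`, seats GR-1 ∕ GR-2, 2026-08-21).

## References

* S. S. Kudla, Israel J. Math. 87 (1994) 361–401, §3 [Kudla1994].
* M. Harris, S. S. Kudla, W. J. Sweet, J. Amer. Math. Soc. 9 (1996) 941–1004, §1 (1.9)–(1.11)
  [HarrisKudlaSweet1996].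
* S. Gelbart, J. Rogawski, Invent. Math. 105 (1991), §3.1 [GelbartRogawski1991].
-/

set_option autoImplicit false

noncomputable section

open NumberField IsDedekindDomain MeasureTheory Matrix
open Literature.RepresentationTheory.HeisenbergGroup
open Literature.NumberTheory.Automorphic Literature.NumberTheory.Weil1964

namespace Literature.NumberTheory.GelbartRogawski1991.UnitaryDualPair.LocalSplitting

variable (F : Type) [Field F] [NumberField F] (E : Type) [Field E] [NumberField E] [Algebra F E]
  [Algebra.IsQuadraticExtension F E] (c : E ≃ₐ[F] E)
  {δ : E} (hcδ : c δ = -δ) (hδ : δ ≠ 0) {d : F} (hd : δ * δ = algebraMap F E d)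
  (v : HeightOneSpectrum (𝓞 F)) (n : ℕ) (T₀ : Matrix (Fin n) (Fin n) F)

/-! ## §1 The doubled Gram matrix -/

/-- `Fin n ⊕ Fin n ≃ Fin (n + n)` — the re-enumeration of the doubled space. [folklore] -/
abbrev e₂ : Fin n ⊕ Fin n ≃ Fin (n + n) := finSumFinEquiv

/-- **`T^𝔻 = T₀ ⊕ (−T₀) ∈ M_{n+n}(F)`**, the `F`-rational Gram matrix of the doubled symplectic space `𝕎 ⊕ 𝕎⁻ = Res(𝕍 ⊕ −𝕍)`.
[cite: HarrisKudlaSweet1996, §1 (1.9)] -/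
abbrev gramD : Matrix (Fin (n + n)) (Fin (n + n)) F :=
  Matrix.reindex (e₂ n) (e₂ n) (Matrix.fromBlocks T₀ 0 0 (-T₀))

/-- `J^𝔻 := T^𝔻 ⊗ 1 ∈ M_{n+n}(E)`, the hermitian matrix of `𝔻 = 𝕍 ⊕ (−𝕍)`. [cite: HarrisKudlaSweet1996, §1 (1.9)] -/
abbrev hermD : Matrix (Fin (n + n)) (Fin (n + n)) E := (gramD F n T₀).map (algebraMap F E)

variable {T₀}

omit [NumberField F] in
/-- `T^𝔻` is symmetric if `T₀` is. [cite: HarrisKudlaSweet1996, §1 (1.9)] -/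
theorem gramD_isSymm (hT₀ : T₀.IsSymm) : (gramD F n T₀).IsSymm := by
  have h : (Matrix.fromBlocks T₀ 0 0 (-T₀)).IsSymm := Matrix.IsSymm.fromBlocks hT₀ (by simp) hT₀.neg
  unfold Matrix.IsSymm at h ⊢
  rw [Matrix.transpose_reindex, h]

omit [NumberField F] in
/-- `det T^𝔻` is a unit if `det T₀` is. [cite: HarrisKudlaSweet1996, §1 (1.9)] -/
theorem isUnit_det_gramD (hT₀d : IsUnit T₀.det) : IsUnit (gramD F n T₀).det := by
  rw [Matrix.det_reindex_self]
  exact isUnit_det_fromBlocks_neg T₀ hT₀d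

variable (T₀)

/-- the `𝕍`-half `x_L` of a vector on `Fin (n + n)`. [folklore] -/
abbrev halfL (x : Fin (n + n) → v.adicCompletion F) : Fin n → v.adicCompletion F := fun i => x (e₂ n (Sum.inl i))

/-- the `−𝕍`-half `x_R`. [folklore] -/
abbrev halfR (x : Fin (n + n) → v.adicCompletion F) : Fin n → v.adicCompletion F := fun i => x (e₂ n (Sum.inr i))

/-- the vector with both halves equal to `a` (a "diagonal" vector). [folklore] -/
def dbl (a : Fin n → v.adicCompletion F) : Fin (n + n) → v.adicCompletion F := fun k => Sum.elim a a ((e₂ n).symm k)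

/-- `(dbl a)_L = a`. [folklore] -/
@[simp] private theorem halfL_dbl (a : Fin n → v.adicCompletion F) : halfL F v n (dbl F v n a) = a := by
  funext i; simp only [halfL, dbl, Equiv.symm_apply_apply, Sum.elim_inl]

/-- `(dbl a)_R = a`. [folklore] -/
@[simp] private theorem halfR_dbl (a : Fin n → v.adicCompletion F) : halfR F v n (dbl F v n a) = a := by
  funext i; simp only [halfR, dbl, Equiv.symm_apply_apply, Sum.elim_inr]

/-- `dbl 0 = 0`. [folklore] -/
@[simp] private theorem dbl_zero : dbl F v n 0 = 0 := by
  funext k; simp only [dbl, Pi.zero_apply]; cases (e₂ n).symm k <;> rfl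

/-- `𝕋^𝔻_v = T₀_v ⊕ (−T₀_v)` (base change commutes with the block structure). [cite: HarrisKudlaSweet1996, §1 (1.9)] -/
theorem localGram_gramD :
    localGram F (n + n) (gramD F n T₀) v =
      Matrix.reindex (e₂ n) (e₂ n)
        (Matrix.fromBlocks (T₀.map (algebraMap F (v.adicCompletion F))) 0 0
          (-(T₀.map (algebraMap F (v.adicCompletion F))))) := by
  ext i j
  simp only [localGram, Matrix.map_apply, Matrix.reindex_apply, Matrix.submatrix_apply]
  rcases (e₂ n).symm i with a | a <;> rcases (e₂ n).symm j with b | b <;>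
    simp [Matrix.fromBlocks, Matrix.of_apply, map_neg, map_zero]

/-- **the local pairing of the doubled datum**: `β_{T^𝔻_v}(x, y) = ⟨x_L, T₀ y_L⟩ − ⟨x_R, T₀ y_R⟩`.
[cite: HarrisKudlaSweet1996, §1 (1.9)] -/
theorem localPairing_gramD (x y : Fin (n + n) → v.adicCompletion F) :
    localPairing F (n + n) (gramD F n T₀) v x y =
      halfL F v n x ⬝ᵥ (T₀.map (algebraMap F (v.adicCompletion F)) *ᵥ halfL F v n y) -
        halfR F v n x ⬝ᵥ (T₀.map (algebraMap F (v.adicCompletion F)) *ᵥ halfR F v n y) := by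
  rw [Matrix.toLinearMap₂'_apply', localGram_gramD]
  rw [dotProduct, ← (e₂ n).sum_comp]
  simp only [Matrix.reindex_apply, Matrix.mulVec, dotProduct, Matrix.submatrix_apply, Equiv.symm_apply_apply]
  rw [Fintype.sum_sum_type]
  have hy : ∀ s : Fin n ⊕ Fin n, (∑ j : Fin (n + n),
      Matrix.fromBlocks (T₀.map (algebraMap F (v.adicCompletion F))) 0 0 (-(T₀.map (algebraMap F (v.adicCompletion F))))
        s ((e₂ n).symm j) * y j) =
      ∑ t : Fin n ⊕ Fin n, Matrix.fromBlocks (T₀.map (algebraMap F (v.adicCompletion F))) 0 0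
        (-(T₀.map (algebraMap F (v.adicCompletion F)))) s t * y (e₂ n t) := by
    intro s
    rw [← (e₂ n).sum_comp]
    simp only [Equiv.symm_apply_apply]
  simp only [hy, Fintype.sum_sum_type, Matrix.fromBlocks_apply₁₁, Matrix.fromBlocks_apply₁₂, Matrix.fromBlocks_apply₂₁,
    Matrix.fromBlocks_apply₂₂, Matrix.zero_apply, zero_mul, Finset.sum_const_zero, add_zero, zero_add,
    Matrix.neg_apply, neg_mul, Finset.sum_neg_distrib, mul_neg]
  simp only [halfL, halfR, sub_eq_add_neg]

/-! ## §2 The Lagrangian `ℓ_Δ = Res Δ` -/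

/-- **the Lagrangian `ℓ_Δ = Res_{E_v/F_v} Δ`** of `𝕎^𝔻_v = F_v^{n+n} × F_v^{n+n}`: pairs `(x, y)` whose `𝕍`- and
`−𝕍`-halves agree (`Δ = {(u, u)}`, real parts `(a, a)`, `δ`-parts `(b, b)`; "`Y` = the graph of the identity map").
[cite: HarrisKudlaSweet1996, §1 (1.11)] -/
def deltaLagrangian : Submodule (v.adicCompletion F)
    ((Fin (n + n) → v.adicCompletion F) × (Fin (n + n) → v.adicCompletion F)) where
  carrier := {p | ∀ i : Fin n, p.1 (e₂ n (Sum.inl i)) = p.1 (e₂ n (Sum.inr i)) ∧ p.2 (e₂ n (Sum.inl i)) = p.2 (e₂ n (Sum.inr i))}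
  add_mem' := by
    intro p q hp hq i
    exact ⟨by simp only [Prod.fst_add, Pi.add_apply, (hp i).1, (hq i).1],
      by simp only [Prod.snd_add, Pi.add_apply, (hp i).2, (hq i).2]⟩
  zero_mem' := fun _ => ⟨rfl, rfl⟩
  smul_mem' := by
    intro a p hp i
    exact ⟨by simp only [Prod.smul_fst, Pi.smul_apply, (hp i).1], by simp only [Prod.smul_snd, Pi.smul_apply, (hp i).2]⟩

/-- membership in `ℓ_Δ`: both coordinate vectors have equal halves. [cite: HarrisKudlaSweet1996, §1 (1.11)] -/
theorem mem_deltaLagrangian_iff (p : (Fin (n + n) → v.adicCompletion F) × (Fin (n + n) → v.adicCompletion F)) :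
    p ∈ deltaLagrangian F v n ↔ halfL F v n p.1 = halfR F v n p.1 ∧ halfL F v n p.2 = halfR F v n p.2 := by
  constructor
  · intro h
    exact ⟨funext fun i => (h i).1, funext fun i => (h i).2⟩
  · rintro ⟨h1, h2⟩ i
    exact ⟨congrFun h1 i, congrFun h2 i⟩

/-- diagonal pairs lie in `ℓ_Δ`. [folklore] -/
private theorem dbl_mem (a b : Fin n → v.adicCompletion F) : (dbl F v n a, dbl F v n b) ∈ deltaLagrangian F v n := by
  intro i
  simp only [dbl, Equiv.symm_apply_apply, Sum.elim_inl, Sum.elim_inr, and_self]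

/-- **`ℓ_Δ` is a Lagrangian**: `ℓ_Δ^⊥ = ℓ_Δ` for the commutator form of the doubled local pairing, when `det T₀`
is a unit (isotropy: `a T₀ b' + a (−T₀) b' = 0`; maximality by testing against `(dbl a, 0)` and `(0, dbl b)`).
[cite: HarrisKudlaSweet1996, §1 (1.11)] -/
theorem deltaLagrangian_orthogonal (hT₀d : IsUnit T₀.det) :
    LinearMap.BilinForm.orthogonal (alt (polar (localPairing F (n + n) (gramD F n T₀) v))) (deltaLagrangian F v n) =
      deltaLagrangian F v n := by
  have hTK : IsUnit (T₀.map (algebraMap F (v.adicCompletion F))).det := by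
    rw [← RingHom.mapMatrix_apply, ← RingHom.map_det]; exact hT₀d.map _
  have hTu : IsUnit (T₀.map (algebraMap F (v.adicCompletion F))) := (Matrix.isUnit_iff_isUnit_det _).2 hTK
  have hinj : Function.Injective fun y : Fin n → v.adicCompletion F => T₀.map (algebraMap F (v.adicCompletion F)) *ᵥ y :=
    Matrix.mulVec_injective_iff_isUnit.2 hTu
  have hsurj : Function.Surjective fun y : Fin n → v.adicCompletion F => T₀.map (algebraMap F (v.adicCompletion F)) *ᵥ y :=
    Matrix.mulVec_surjective_iff_isUnit.2 hTu
  ext m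
  rw [LinearMap.BilinForm.mem_orthogonal_iff, mem_deltaLagrangian_iff]
  constructor
  · intro h
    have h1 : ∀ a : Fin n → v.adicCompletion F,
        a ⬝ᵥ (T₀.map (algebraMap F (v.adicCompletion F)) *ᵥ (halfL F v n m.2 - halfR F v n m.2)) = 0 := by
      intro a
      have := h (dbl F v n a, 0) (by simpa only [dbl_zero] using dbl_mem F v n a 0)
      simp only [alt_apply, polar_apply, localPairing_gramD, halfL_dbl, halfR_dbl, map_zero,
        sub_zero] at this
      rwa [Matrix.mulVec_sub, dotProduct_sub]
    have h2 : ∀ b : Fin n → v.adicCompletion F,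
        (halfL F v n m.1 - halfR F v n m.1) ⬝ᵥ (T₀.map (algebraMap F (v.adicCompletion F)) *ᵥ b) = 0 := by
      intro b
      have := h (0, dbl F v n b) (by simpa only [dbl_zero] using dbl_mem F v n 0 b)
      simp only [alt_apply, polar_apply, localPairing_gramD, halfL_dbl, halfR_dbl, map_zero,
        zero_sub, neg_eq_zero, LinearMap.zero_apply] at this
      rw [sub_dotProduct]
      simpa [halfL, halfR] using this
    refine ⟨?_, ?_⟩
    · have hz : halfL F v n m.1 - halfR F v n m.1 = 0 := by
        funext i
        obtain ⟨b, hb⟩ := hsurj (Pi.single i 1)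
        have := h2 b
        have hb' : T₀.map (algebraMap F (v.adicCompletion F)) *ᵥ b = Pi.single i 1 := hb
        rw [hb', dotProduct_single, mul_one] at this
        exact this
      exact sub_eq_zero.1 hz
    · have hz : T₀.map (algebraMap F (v.adicCompletion F)) *ᵥ (halfL F v n m.2 - halfR F v n m.2) = 0 := by
        funext i
        have := h1 (Pi.single i 1)
        rwa [single_dotProduct, one_mul] at this
      have : halfL F v n m.2 - halfR F v n m.2 = 0 := hinj (by simpa using hz)
      exact sub_eq_zero.1 this
  · rintro ⟨h1, h2⟩ p hp
    rw [mem_deltaLagrangian_iff] at hp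
    simp only [alt_apply, polar_apply, localPairing_gramD, hp.1, hp.2, h1, h2, sub_self]

/-! ## §3 `ι^𝔻_v`, the Siegel parabolic `P_Δ`, `det_Δ` and `χ_v(det_Δ ·)` -/

variable {T₀} (hT₀ : T₀.IsSymm) (hT₀d : IsUnit T₀.det)
  {JD : Matrix (Fin (n + n)) (Fin (n + n)) E} (hJD : JD = (gramD F n T₀).map (algebraMap F E))

/-- **`ι^𝔻_v : H(F_v) = U(J^𝔻)(F_v) →* Sp(𝕎^𝔻_v)`** — the interface's `iota` at the doubled datum.
[cite: HarrisKudlaSweet1996, §1 (1.10)] -/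
abbrev iotaD : UnitaryGroup.localPi E c (n + n) JD v →* LocalSp F (n + n) (gramD F n T₀) v :=
  iota F E c (n + n) hcδ hδ hd (gramD F n T₀) (gramD_isSymm F n hT₀) hJD v

/-- the linear map underlying an element of `Sp(𝕎_v)` (for `Submodule.map`). [folklore] -/
abbrev toLin {N : ℕ} {T : Matrix (Fin N) (Fin N) F} (g : LocalSp F N T v) :
    ((Fin N → v.adicCompletion F) × (Fin N → v.adicCompletion F)) →ₗ[v.adicCompletion F]
      ((Fin N → v.adicCompletion F) × (Fin N → v.adicCompletion F)) :=
  ((g : ((Fin N → v.adicCompletion F) × (Fin N → v.adicCompletion F)) ≃ₗ[v.adicCompletion F]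
      ((Fin N → v.adicCompletion F) × (Fin N → v.adicCompletion F))) :
    ((Fin N → v.adicCompletion F) × (Fin N → v.adicCompletion F)) →ₗ[v.adicCompletion F]
      ((Fin N → v.adicCompletion F) × (Fin N → v.adicCompletion F)))

/-- **`h ∈ P_Δ(F_v)`** (the Siegel parabolic of the doubled group): `ι^𝔻_v(h)` stabilises `ℓ_Δ` — equivalently
the block condition `h₁₁ + h₁₂ = h₂₁ + h₂₂`. [cite: Kudla1994, §3; HarrisKudlaSweet1996, §1 (1.11)] -/
def IsSiegelDelta (h : UnitaryGroup.localPi E c (n + n) JD v) : Prop :=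
  (deltaLagrangian F v n).map (toLin F v (iotaD F E c hcδ hδ hd v n hT₀ hJD h)) = deltaLagrangian F v n

/-- the `Δ`-block `h₁₁ + h₁₂` of `h ∈ H(F_v)` at a place `w ∣ v` (the action of `h ∈ P_Δ` on `Δ ≅ E_w^n`).
[cite: Kudla1994, §3] -/
def deltaBlock (w : UnitaryGroup.PlacesOver E v) (h : UnitaryGroup.localPi E c (n + n) JD v) :
    Matrix (Fin n) (Fin n) (w.1.adicCompletion E) :=
  let M : Matrix (Fin n ⊕ Fin n) (Fin n ⊕ Fin n) (w.1.adicCompletion E) :=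
    Matrix.reindex (e₂ n).symm (e₂ n).symm
      (((h : UnitaryGroup.LocalGLPi E (n + n) v) w : GL (Fin (n + n)) (w.1.adicCompletion E)) :
        Matrix (Fin (n + n)) (Fin (n + n)) (w.1.adicCompletion E))
  M.toBlocks₁₁ + M.toBlocks₁₂

/-- `det_Δ h := det (h₁₁ + h₁₂) ∈ E_w` — Kudla's `x(p)` on the Siegel parabolic. [cite: Kudla1994, §3; HarrisKudlaSweet1996, §1 (1.15)] -/
def detDelta (w : UnitaryGroup.PlacesOver E v) (h : UnitaryGroup.localPi E c (n + n) JD v) : w.1.adicCompletion E :=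
  (deltaBlock F E c v n w h).det

/-- **`χ_v(det_Δ h) := ∏_{w ∣ v} χ_w(det_Δ h_w)`** for a family of characters `χ_w : E_wˣ →* ℂˣ` (the component at
`v` of a Hecke character of `E`; one factor at a non-split place, two at a split place); value `1` off units.
[cite: HarrisKudlaSweet1996, §1 (1.15)] -/
def chiDet (χv : ∀ w : UnitaryGroup.PlacesOver E v, (w.1.adicCompletion E)ˣ →* ℂˣ)
    (h : UnitaryGroup.localPi E c (n + n) JD v) : ℂˣ :=
  open scoped Classical in
  ∏ w : UnitaryGroup.PlacesOver E v, if hu : IsUnit (detDelta F E c v n w h) then χv w hu.unit else 1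

/-! ### Build-lane note (ops-buildfix G11b-3 recipe, LEDGER B13-1, 2026-08-21)
`lean -o` (the hub build lane, never `lean`/the gate check) runs Lean 4.32's library-suggestion indexers
(`Lean.LibrarySuggestions.SymbolFrequency` / `SineQuaNon`, from their `exportEntriesFn`) over the statement of
every local theorem that is not a denied premise; on this family's statements (very large dependent binder
telescopes through the theta-kernel / dual-pair data) that fold runs for tens of minutes to hours and the build
lane kills the job (incident G11b-3, run/shared/lean/ops/buildfix/G11b-3-DOSSIER.md). `isDeniedPremise` skips
`[implicit_reducible]` constants before any fold, and a reducibility status on a *theorem* is inert (Meta never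
unfolds `thmInfo`; the kernel ignores the attribute), so the public theorems of this file are tagged
`[implicit_reducible]` purely to keep them out of that index. Only other effect: they are not offered by
`+suggestions` premise selectors. No statement or proof is changed; superseded if the operator lands a
deny-list form (`HarnessLib.PremiseIndex`). -/
set_option allowUnsafeReducibility true in
attribute [implicit_reducible]
  gramD_isSymm isUnit_det_gramD localGram_gramD localPairing_gramD mem_deltaLagrangian_iff
  deltaLagrangian_orthogonal

end Literature.NumberTheory.GelbartRogawski1991.UnitaryDualPair.LocalSplitting

end
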